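import Mathlib
import Summits.Ventures.HodgeRepro2.T5RecordSatakeDifferent
import Summits.Ventures.HodgeRepro2.T5CMFieldSquareDatum

/-!
# THE RELATIVE DIFFERENT DIVIDES `(2y)`: THE EXCEPTIONAL SET IS CONTAINED IN THE PLACES DIVIDING `4θ`

Tier-5 support N3 / §G-N4.2 (seat p3, gen 82). File 313 bounds the exceptional set of the record's Hecke
commutativity by the support of the relative different `𝔇_{K/K⁺}`; this file bounds the different itself by the
record's own datum: for the integral datum `(d, x)` of file 235 (`d ∈ 𝓞_{K⁺}`, `x ∈ 𝓞_K`, `x² = d`, `c(x) ≠ x`),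
`K = K⁺(x)`, the minimal polynomial of `x` over `𝓞_{K⁺}` is `X² − d`, and Mathlib's
`aeval_derivative_mem_differentIdeal` puts `2x` into `𝔇_{K/K⁺}`. Hence a prime of `K` dividing the different
contains `2x`, so its contraction contains `(2x)² = 4d`: MVW's «unramified outside `2θ`» (R1's (u3)/(u4)) in kernel.

* `adjoin_eq_top` (`K⁺[x] = K`), `minpoly_field_eq` (`minpoly K⁺ x = X² − d`, irreducible because `c(x) ≠ x`),
  **`minpoly_eq`** (`minpoly 𝓞_{K⁺} x = X² − d`), `aeval_derivative_eq` (`(minpoly)'(x) = 2x`);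
* **`two_mul_mem_differentIdeal`** — `2x ∈ 𝔇_{K/K⁺}`; **`four_mul_mem_under_of_dvd_differentIdeal`** — a prime
  divisor of `𝔇` lies over a prime containing `4d`; `not_dvd_differentIdeal_of_notMem`;
* **`recordCommutative_of_four_mul_notMem`** — `H(U(1 ⊗ H), K_v)` is commutative at every place `v` of `K⁺` with
  `4d ∉ v` (good for `H`); **`subset_setOf_four_mul_mem`**, **`finite_setOf_four_mul_mem`** — for an integral
  unimodular `H` the exceptional set is contained in the finite set of places of `K⁺` dividing `(4d)`.

§8(d): uses an L-value-free non-vanishing device: NO.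
-/

open Matrix NumberField NumberField.IsCMField IsDedekindDomain IsDedekindDomain.HeightOneSpectrum Module Polynomial
  Ideal
open scoped TensorProduct Pointwise
open Summit.Ventures.HodgeRepro2.T5UnitaryGroupForm Summit.Ventures.HodgeRepro2.T5UnitaryHeckeAdjoint
  Summit.Ventures.HodgeRepro2.T5HeckePermutationModule Summit.Ventures.HodgeRepro2.T5HeckeDoubleCoset
  Summit.Ventures.HodgeRepro2.T5RecordHyperspecial Summit.Ventures.HodgeRepro2.T5GlobalLatticeAlmostAll
  Summit.Ventures.HodgeRepro2.T5FinitePlaceSplitClassification Summit.Ventures.HodgeRepro2.T5RecordSatakeIntrinsic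
  Summit.Ventures.HodgeRepro2.T5SplitPlaceUnitaryGroup Summit.Ventures.HodgeRepro2.T5NonSplitPlaceUnitaryGroup
  Summit.Ventures.HodgeRepro2.T5FinitePlaceCM Summit.Ventures.HodgeRepro2.T5StarOfInvolution
  Summit.Ventures.HodgeRepro2.T5CyclotomicSubfieldHeckeCommutative
  Summit.Ventures.HodgeRepro2.T5IntegralGramBadSet Summit.Ventures.HodgeRepro2.T5RecordSatakeDifferent
  Summit.Ventures.HodgeRepro2.T5CMFieldSquareDatum

namespace Summit.Ventures.HodgeRepro2.T5RecordSatakeDifferentDatum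

section Minpoly

variable (K : Type*) [Field K] [NumberField K] [IsCMField K]
variable (d : 𝓞 (maximalRealSubfield K)) (x : 𝓞 K)
  (hdx : algebraMap (maximalRealSubfield K) K (algebraMap (𝓞 (maximalRealSubfield K)) (maximalRealSubfield K) d) =
    (algebraMap (𝓞 K) K x) ^ 2)
  (hx : complexConj K (algebraMap (𝓞 K) K x) ≠ algebraMap (𝓞 K) K x)

include hx in
/-- **`K = K⁺[x]`**: `x` generates `K` over `K⁺` (`{1, x}` spans, file 122's `span_pair_eq_top`). -/
theorem adjoin_eq_top : Algebra.adjoin (maximalRealSubfield K) {algebraMap (𝓞 K) K x} = ⊤ := by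
  apply top_le_iff.mp
  intro z _
  have hz : z ∈ Submodule.span (maximalRealSubfield K) {(1 : K), algebraMap (𝓞 K) K x} := by
    rw [span_pair_eq_top K hx]
    trivial
  have hle : Submodule.span (maximalRealSubfield K) {(1 : K), algebraMap (𝓞 K) K x} ≤
      Subalgebra.toSubmodule (Algebra.adjoin (maximalRealSubfield K) {algebraMap (𝓞 K) K x}) := by
    rw [Submodule.span_le]
    rintro w (rfl | rfl)
    · exact Subalgebra.one_mem _
    · exact Algebra.self_mem_adjoin_singleton _ _
  exact hle hz

include hdx hx in
/-- **`minpoly K⁺ x = X² − d`**: `X² − d` is irreducible over `K⁺` (`d` is not a square in `K⁺`: a square root `b`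
would give `x = ±b`, fixed by the conjugation), `x` is a root, and it is monic. -/
theorem minpoly_field_eq :
    minpoly (maximalRealSubfield K) (algebraMap (𝓞 K) K x) =
      X ^ 2 - C (algebraMap (𝓞 (maximalRealSubfield K)) (maximalRealSubfield K) d) := by
  symm
  apply minpoly.eq_of_irreducible_of_monic
  · refine (X_pow_sub_C_irreducible_iff_of_prime Nat.prime_two).mpr fun b hb => hx ?_
    have h2 : (algebraMap (𝓞 K) K x) ^ 2 = (algebraMap (maximalRealSubfield K) K b) ^ 2 := by
      rw [← hdx, ← hb, map_pow]
    rcases sq_eq_sq_iff_eq_or_eq_neg.mp h2 with h | h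
    · rw [h]
      exact complexConj_apply_eq_self K b
    · rw [h, map_neg]
      exact congrArg Neg.neg (complexConj_apply_eq_self K b)
  · rw [map_sub, map_pow, aeval_X, aeval_C, ← hdx, sub_self]
  · exact monic_X_pow_sub_C _ two_ne_zero

include hdx hx in
/-- **`minpoly 𝓞_{K⁺} x = X² − d`** (Mathlib's `minpoly.isIntegrallyClosed_eq_field_fractions`). -/
theorem minpoly_eq : minpoly (𝓞 (maximalRealSubfield K)) x = X ^ 2 - C d := by
  have hint : IsIntegral (𝓞 (maximalRealSubfield K)) x := Algebra.IsIntegral.isIntegral x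
  have h := minpoly.isIntegrallyClosed_eq_field_fractions (maximalRealSubfield K) K hint
  rw [minpoly_field_eq K d x hdx hx] at h
  apply Polynomial.map_injective (algebraMap (𝓞 (maximalRealSubfield K)) (maximalRealSubfield K))
    (FaithfulSMul.algebraMap_injective _ _)
  rw [← h, Polynomial.map_sub, Polynomial.map_pow, Polynomial.map_X, Polynomial.map_C]

include hdx hx in
/-- `(minpoly 𝓞_{K⁺} x)'(x) = 2x`. -/
theorem aeval_derivative_eq : aeval x (derivative (minpoly (𝓞 (maximalRealSubfield K)) x)) = 2 * x := by
  rw [minpoly_eq K d x hdx hx, derivative_sub, derivative_X_pow, derivative_C, sub_zero]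
  simp only [map_mul, map_pow, aeval_X, Nat.cast_ofNat, map_ofNat]
  norm_num

include hdx hx in
/-- **`2x ∈ 𝔇_{K/K⁺}`** (Mathlib's `aeval_derivative_mem_differentIdeal` for the generator `x` of `K/K⁺`). -/
theorem two_mul_mem_differentIdeal : 2 * x ∈ differentIdeal (𝓞 (maximalRealSubfield K)) (𝓞 K) := by
  rw [← aeval_derivative_eq K d x hdx hx]
  exact aeval_derivative_mem_differentIdeal (𝓞 (maximalRealSubfield K)) (maximalRealSubfield K) K x
    (adjoin_eq_top K x hx)

omit [NumberField K] [IsCMField K] in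
include hdx in
/-- `x² = d` in `𝓞_K`. -/
theorem sq_eq : x ^ 2 = algebraMap (𝓞 (maximalRealSubfield K)) (𝓞 K) d := by
  apply FaithfulSMul.algebraMap_injective (𝓞 K) K
  rw [map_pow, ← hdx, ← IsScalarTower.algebraMap_apply, ← IsScalarTower.algebraMap_apply]

include hdx hx in
/-- **A prime divisor of `𝔇_{K/K⁺}` lies over a prime containing `4d`**: `2x ∈ w`, so `(2x)² = 4d ∈ w`. -/
theorem four_mul_mem_under_of_dvd_differentIdeal (w : HeightOneSpectrum (𝓞 K))
    (hw : w.asIdeal ∣ differentIdeal (𝓞 (maximalRealSubfield K)) (𝓞 K)) :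
    4 * d ∈ w.asIdeal.under (𝓞 (maximalRealSubfield K)) := by
  have h2 : 2 * x ∈ w.asIdeal := (Ideal.dvd_iff_le.mp hw) (two_mul_mem_differentIdeal K d x hdx hx)
  have h4 : (2 * x) ^ 2 ∈ w.asIdeal := Ideal.pow_mem_of_mem (I := w.asIdeal) h2 2 two_pos
  rw [Ideal.under, Ideal.mem_comap, map_mul, ← sq_eq K d x hdx]
  convert h4 using 1
  rw [mul_pow, map_ofNat]
  norm_num

include hdx hx in
/-- `4d ∉ w.under ⇒ w ∤ 𝔇_{K/K⁺}`. -/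
theorem not_dvd_differentIdeal_of_notMem (w : HeightOneSpectrum (𝓞 K))
    (h : 4 * d ∉ w.asIdeal.under (𝓞 (maximalRealSubfield K))) :
    ¬ w.asIdeal ∣ differentIdeal (𝓞 (maximalRealSubfield K)) (𝓞 K) :=
  fun hw => h (four_mul_mem_under_of_dvd_differentIdeal K d x hdx hx w hw)

end Minpoly

section Record

variable (K : Type*) [Field K] [NumberField K] [IsCMField K]
variable (d : 𝓞 (maximalRealSubfield K)) (x : 𝓞 K)
  (hdx : algebraMap (maximalRealSubfield K) K (algebraMap (𝓞 (maximalRealSubfield K)) (maximalRealSubfield K) d) =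
    (algebraMap (𝓞 K) K x) ^ 2)
  (hx : complexConj K (algebraMap (𝓞 K) K x) ≠ algebraMap (𝓞 K) K x)
variable (v : HeightOneSpectrum (𝓞 (maximalRealSubfield K)))
variable {r : ℕ} (l : Fin r → 𝓞 K) (k : Type*) [Field k]
  (hl : Submodule.span (𝓞 (maximalRealSubfield K)) (Set.range l) = ⊤)

include hdx hx hl in
/-- **COMMUTATIVE AT EVERY PLACE `v` OF `K⁺` WITH `4d ∉ v`**, for every hermitian `H` with unit determinant good above
`v`: MVW's «non-dyadic, unramified» in kernel (every `w ∣ v` has `w ∤ 𝔇`, file 313). -/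
theorem recordCommutative_of_four_mul_notMem (hv : 4 * d ∉ v.asIdeal)
    {H : Matrix (Fin 3) (Fin 3) K} (hH : H.IsHermitian) (hdet : IsUnit H.det)
    (hbad : ∀ w : HeightOneSpectrum (𝓞 K), w.asIdeal.LiesOver v.asIdeal → w ∉ badSet H) :
    RecordCommutative K v l k H := by
  obtain ⟨P, hP, hPv⟩ := (Ideal.nonempty_primesOver (S := 𝓞 K) v.asIdeal).some
  haveI := hP
  haveI := hPv
  let w : HeightOneSpectrum (𝓞 K) := ⟨P, hP, Ideal.ne_bot_of_liesOver_of_ne_bot v.ne_bot P⟩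
  haveI : w.asIdeal.LiesOver v.asIdeal := hPv
  have hw : ¬ w.asIdeal ∣ differentIdeal (𝓞 (maximalRealSubfield K)) (𝓞 K) :=
    not_dvd_differentIdeal_of_notMem K d x hdx hx w (by rw [← hPv.over]; exact hv)
  exact recordCommutative_of_not_dvd_differentIdeal K v l k w hw hl hH hdet (hbad w hPv)

variable (M : Matrix (Fin 3) (Fin 3) (𝓞 K)) (hM : IsUnit M.det)
  (hH : ((algebraMap (𝓞 K) K).mapMatrix M).IsHermitian)

include hdx hx hl hM hH in
/-- **For an integral unimodular `H`, the exceptional set is contained in the places of `K⁺` dividing `(4d)`.** -/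
theorem subset_setOf_four_mul_mem :
    {v : HeightOneSpectrum (𝓞 (maximalRealSubfield K)) |
        ¬ RecordCommutative K v l k ((algebraMap (𝓞 K) K).mapMatrix M)} ⊆
      {v : HeightOneSpectrum (𝓞 (maximalRealSubfield K)) | 4 * d ∈ v.asIdeal} := by
  intro v hv
  by_contra hnot
  exact hv (recordCommutative_of_four_mul_notMem K d x hdx hx v l k hl hnot hH (isUnit_det_mapMatrix M hM)
    (forall_notMem_badSet_mapMatrix v M hM))

omit [IsCMField K] in
/-- **The places of `K⁺` dividing `(4d)` form a finite set** (`4d ≠ 0`). -/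
theorem finite_setOf_four_mul_mem (hd : d ≠ 0) :
    {v : HeightOneSpectrum (𝓞 (maximalRealSubfield K)) | 4 * d ∈ v.asIdeal}.Finite := by
  refine (Ideal.finite_factors (I := Ideal.span {4 * d}) ?_).subset ?_
  · rw [Ne, Submodule.zero_eq_bot, Ideal.span_singleton_eq_bot]
    exact mul_ne_zero (by norm_num) hd
  · intro v hv
    exact Ideal.dvd_span_singleton.mpr hv

end Record

end Summit.Ventures.HodgeRepro2.T5RecordSatakeDifferentDatum
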